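import Summits.AtomisticToContinuum.HydrodynamicLimit.Theorems.JParityClosureParityBandClosureWindowCovarianceIsotropyK
import HarnessLib

/-!
# Window covariance isotropy (crux `JParityClosure.ParityBandClosure`, stmt-AtomisticToContinuum-17608, line
# `transfer-weighted-parity-chain`, stub `stub_windowCovarianceIsotropy`) — helper L: window Fubini utilities and time-integrated moments

WHAT.  `pathwise_bound`: along ONE good hard-sphere orbit, given the deterministic data of the assembly (the energy
per particle `≤ Ē`, the time-integrated cubic tail above `V` `≤ Tt`, the normalised quartic collision functional of
`CollisionTightness` `≤ Kb`, the window integrals of the two pointwise kinetic inputs `≤ η'_O, η'_R` for each of the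
finitely many tests, and `ε_N` small enough for the balance tests), the `g(σ³ρ_w)`-weighted `L¹(dt₀ dx₀)` norm of
the deviator of the window covariances is bounded by the explicit budget
`144(ε+ε²)Gbτ + 32GbTt + 4V²[Gbρ_min τ + ρ̄nη'_O/η + ρ̄Gbnη'_R/η + ρ̄Gb·24Kb/M + ρ̄Gb·8(2VĒτ + Tt)/(Mρ_min)]`.
Proof: the window bound of helper J, integrated over the windows with the Fubini lemmas of helper H (law-type
functionals against time-integrated velocity moments, record-type functionals against the collision functional),
every window functional being jointly measurable (helper F) and bounded (helper G).

REFERENCES.  The line's card; H. Spohn (1991), Part I §3.  No named fact is invoked.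
-/

noncomputable section

namespace Summit.AtomisticToContinuum.HydrodynamicLimit.Theorems.ParityBandClosureWindowCovariance

open scoped BigOperators Topology Classical MeasureTheory ENNReal InnerProductSpace
open Filter Set MeasureTheory Function Topology
open Literature.MathematicalPhysics.KineticTheory
open Literature.Analysis.FluidPDE
open Summit.AtomisticToContinuum.HydrodynamicLimit.Theorems.LocalSecondLawNegative (cone cone_nonneg cone_le
  continuous_cone integral_cone_le)
open Summit.AtomisticToContinuum.HydrodynamicLimit.Theorems.ChaosClosesEulerStressIsotropy (sqTail cubeTail
  sqTail_nonneg cubeTail_nonneg measurable_sqTail measurable_cubeTail norm_sq_le_add_sqTail sqTail_le_cubeTail)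

variable {N : ℕ}

/-! ## §1 Bounded measurable window integrands -/

/-- A jointly measurable window integrand bounded by `K` is integrable in `x₀` at every `t₀` and its space integral
is integrable in `t₀` on every `[0, τ]`. [folklore] -/
theorem winIntegrable {A : ℝ × T3 → ℝ} (hm : Measurable A) (hb' : ∃ K : ℝ, ∀ p, |A p| ≤ K) (τ : ℝ) :
    (∀ t₀, Integrable (fun x₀ : T3 => A (t₀, x₀))) ∧
    Integrable (fun t₀ => ∫ x₀ : T3, A (t₀, x₀)) (volume.restrict (Set.Icc (0 : ℝ) τ)) := by
  obtain ⟨K, hb⟩ := hb'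
  haveI : IsFiniteMeasure (volume.restrict (Set.Icc (0 : ℝ) τ)) :=
    ⟨by rw [Measure.restrict_apply_univ, Real.volume_Icc]; exact ENNReal.ofReal_lt_top⟩
  have h1 : ∀ t₀, Integrable (fun x₀ : T3 => A (t₀, x₀)) := fun t₀ =>
    Integrable.mono' (integrable_const K) ((hm.comp (measurable_const.prodMk measurable_id)).aestronglyMeasurable)
      (Eventually.of_forall fun x₀ => by rw [Real.norm_eq_abs]; exact hb _)
  refine ⟨h1, ?_⟩
  have h2 : Measurable fun t₀ => ∫ x₀ : T3, A (t₀, x₀) := by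
    have h := (hm.stronglyMeasurable.integral_prod_right' (ν := (volume : Measure T3))).measurable
    exact h
  refine Integrable.mono' (integrable_const K) h2.aestronglyMeasurable (Eventually.of_forall fun t₀ => ?_)
  have h := norm_integral_le_of_norm_le_const (μ := (volume : Measure T3)) (f := fun x₀ => A (t₀, x₀)) (C := K)
    (Eventually.of_forall fun x₀ => by rw [Real.norm_eq_abs]; exact hb _)
  rwa [probReal_univ, mul_one] at h

/-- Additivity of the window double integral for bounded measurable integrands. [folklore] -/
theorem winIntegral_add {A B : ℝ × T3 → ℝ} (hA : Measurable A) (hbA : ∃ K : ℝ, ∀ p, |A p| ≤ K)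
    (hB : Measurable B) (hbB : ∃ K : ℝ, ∀ p, |B p| ≤ K) (τ : ℝ) :
    ∫ t₀ in Set.Icc (0 : ℝ) τ, ∫ x₀ : T3, (A (t₀, x₀) + B (t₀, x₀)) =
      (∫ t₀ in Set.Icc (0 : ℝ) τ, ∫ x₀ : T3, A (t₀, x₀)) + ∫ t₀ in Set.Icc (0 : ℝ) τ, ∫ x₀ : T3, B (t₀, x₀) := by
  obtain ⟨hA1, hA2⟩ := winIntegrable hA hbA τ
  obtain ⟨hB1, hB2⟩ := winIntegrable hB hbB τ
  rw [← integral_add hA2 hB2]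
  exact integral_congr_ae (Eventually.of_forall fun t₀ => integral_add (hA1 t₀) (hB1 t₀))

/-- Monotonicity of the window double integral against a bounded measurable majorant of a nonnegative integrand.
[folklore] -/
theorem winIntegral_mono {f : ℝ → T3 → ℝ} {A : ℝ × T3 → ℝ} (hA : Measurable A) (hb : ∃ K : ℝ, ∀ p, |A p| ≤ K)
    (hf0 : ∀ t₀ x₀, 0 ≤ f t₀ x₀) (hle : ∀ t₀ x₀, f t₀ x₀ ≤ A (t₀, x₀)) (τ : ℝ) :
    ∫ t₀ in Set.Icc (0 : ℝ) τ, ∫ x₀ : T3, f t₀ x₀ ≤ ∫ t₀ in Set.Icc (0 : ℝ) τ, ∫ x₀ : T3, A (t₀, x₀) := by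
  obtain ⟨hA1, hA2⟩ := winIntegrable hA hb τ
  exact integral_mono_of_nonneg (Eventually.of_forall fun t₀ => integral_nonneg fun x₀ => hf0 t₀ x₀) hA2
    (Eventually.of_forall fun t₀ => integral_mono_of_nonneg (Eventually.of_forall fun x₀ => hf0 t₀ x₀) (hA1 t₀)
      (Eventually.of_forall fun x₀ => hle t₀ x₀))

/-- A constant window integrand integrates to `τ` times the constant (`0 ≤ τ`; `𝕋³` has unit volume). [folklore] -/
theorem winIntegral_const {τ : ℝ} (hτ : 0 ≤ τ) (c : ℝ) :
    ∫ _t₀ in Set.Icc (0 : ℝ) τ, ∫ _x₀ : T3, c = τ * c := by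
  have h1 : (∫ _x₀ : T3, c) = c := by rw [integral_const, probReal_univ, one_smul]
  rw [h1, setIntegral_const, measureReal_def, Real.volume_Icc, sub_zero, ENNReal.toReal_ofReal hτ, smul_eq_mul]

/-- Sums of bounded window integrands are bounded. [folklore] -/
theorem bdd_add {A B : ℝ × T3 → ℝ} (hA : ∃ K : ℝ, ∀ p, |A p| ≤ K) (hB : ∃ K : ℝ, ∀ p, |B p| ≤ K) :
    ∃ K : ℝ, ∀ p, |A p + B p| ≤ K := by
  obtain ⟨KA, hA⟩ := hA; obtain ⟨KB, hB⟩ := hB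
  exact ⟨KA + KB, fun p => (abs_add_le _ _).trans (add_le_add (hA p) (hB p))⟩

/-- Constant multiples of bounded window integrands are bounded. [folklore] -/
theorem bdd_const_mul {A : ℝ × T3 → ℝ} (c : ℝ) (hA : ∃ K : ℝ, ∀ p, |A p| ≤ K) :
    ∃ K : ℝ, ∀ p, |c * A p| ≤ K := by
  obtain ⟨KA, hA⟩ := hA
  exact ⟨|c| * KA, fun p => by rw [abs_mul]; exact mul_le_mul_of_nonneg_left (hA p) (abs_nonneg _)⟩

/-- The window double integral of a constant multiple. [folklore] -/
theorem winIntegral_const_mul (c : ℝ) (A : ℝ × T3 → ℝ) (τ : ℝ) :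
    ∫ t₀ in Set.Icc (0 : ℝ) τ, ∫ x₀ : T3, c * A (t₀, x₀) = c * ∫ t₀ in Set.Icc (0 : ℝ) τ, ∫ x₀ : T3, A (t₀, x₀) := by
  rw [← integral_const_mul]
  exact integral_congr_ae (Eventually.of_forall fun t₀ => integral_const_mul _ _)

/-- The window double integral of a finite sum of bounded measurable integrands. [folklore] -/
theorem winIntegral_finset_sum {ι : Type*} (S : Finset ι) {A : ι → ℝ × T3 → ℝ} (hm : ∀ i, Measurable (A i))
    (hb : ∀ i, ∃ K : ℝ, ∀ p, |A i p| ≤ K) (τ : ℝ) :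
    ∫ t₀ in Set.Icc (0 : ℝ) τ, ∫ x₀ : T3, ∑ i ∈ S, A i (t₀, x₀) = ∑ i ∈ S, ∫ t₀ in Set.Icc (0 : ℝ) τ, ∫ x₀ : T3, A i (t₀, x₀) := by
  have h1 : ∀ i, ∀ t₀, Integrable (fun x₀ : T3 => A i (t₀, x₀)) := fun i => (winIntegrable (hm i) (hb i) τ).1
  have h2 : ∀ i, Integrable (fun t₀ => ∫ x₀ : T3, A i (t₀, x₀)) (volume.restrict (Set.Icc (0 : ℝ) τ)) := fun i =>
    (winIntegrable (hm i) (hb i) τ).2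
  rw [← integral_finsetSum _ fun i _ => h2 i]
  exact integral_congr_ae (Eventually.of_forall fun t₀ => integral_finsetSum _ fun i _ => h1 i t₀)

/-! ## §2 Time-integrated velocity moments along the path -/

section Moments

variable {ε τ : ℝ} {γ : ℝ → Config (N + 1) (Fin 3) T3}

/-- Along a trajectory, the mean quadratic tail above `V ≥ 1` integrates in time below the mean cubic tail.
[folklore] -/
theorem setIntegral_mean_sqTail_le (hγ : IsHardSphereTrajectory (Torus.geometry (Fin 3)) ε (N + 1) γ) {V : ℝ}
    (hV : 1 ≤ V) (τ : ℝ) :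
    ∫ s in Set.Icc (0 : ℝ) τ, ((N + 1 : ℕ) : ℝ)⁻¹ * ∑ k, sqTail V (γ s k).2 ≤
      ∫ s in Set.Icc (0 : ℝ) τ, ((N + 1 : ℕ) : ℝ)⁻¹ * ∑ k, cubeTail V (γ s k).2 := by
  set R := Real.sqrt (2 * configEnergy (γ 0)) with hRdef
  have hR : ∀ s k, ‖(γ s k).2‖ ≤ R := norm_vel_le_sqrt_of_isHardSphereTrajectory hγ
  have hR0 : 0 ≤ R := Real.sqrt_nonneg _
  have hγm := hγ.measurable_torus
  have hvk : ∀ k : Fin (N + 1), Measurable fun s : ℝ => (γ s k).2 := fun k => ((measurable_pi_apply k).comp hγm).snd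
  have hcb : ∀ s k, cubeTail V (γ s k).2 ≤ R ^ 3 := fun s k => by
    unfold cubeTail
    by_cases h : (γ s k).2 ∈ {v : V3 | V < ‖v‖}
    · rw [Set.indicator_of_mem h]; exact pow_le_pow_left₀ (norm_nonneg _) (hR s k) 3
    · rw [Set.indicator_of_notMem h]; positivity
  have hint : ∀ {f : V3 → ℝ}, Measurable f → (∀ v, 0 ≤ f v) → (∀ s k, f (γ s k).2 ≤ R ^ 3) →
      IntegrableOn (fun s => ((N + 1 : ℕ) : ℝ)⁻¹ * ∑ k, f (γ s k).2) (Set.Icc (0 : ℝ) τ) volume := by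
    intro f hf hf0 hfb
    refine Measure.integrableOn_of_bounded (M := ((N + 1 : ℕ) : ℝ)⁻¹ * ∑ _k : Fin (N + 1), R ^ 3)
      (by rw [Real.volume_Icc]; exact ENNReal.ofReal_ne_top)
      ((measurable_const.mul (Finset.measurable_sum _ fun k _ => hf.comp (hvk k))).aestronglyMeasurable)
      (ae_of_all _ fun s => ?_)
    rw [Real.norm_eq_abs, abs_of_nonneg (mul_nonneg (by positivity) (Finset.sum_nonneg fun k _ => hf0 _))]
    exact mul_le_mul_of_nonneg_left (Finset.sum_le_sum fun k _ => hfb s k) (by positivity)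
  refine integral_mono (hint (measurable_sqTail V) (sqTail_nonneg V) fun s k =>
    (sqTail_le_cubeTail hV _).trans (hcb s k)) (hint (measurable_cubeTail V) (cubeTail_nonneg V) hcb) fun s => ?_
  exact mul_le_mul_of_nonneg_left (Finset.sum_le_sum fun k _ => sqTail_le_cubeTail hV _) (by positivity)

/-- `‖v‖³ ≤ V ‖v‖² + cubeTail V v`. [folklore] -/
theorem norm_cube_le {V : ℝ} (hV : 0 ≤ V) (v : V3) : ‖v‖ ^ 3 ≤ V * ‖v‖ ^ 2 + cubeTail V v := by
  unfold cubeTail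
  by_cases h : v ∈ {v : V3 | V < ‖v‖}
  · rw [Set.indicator_of_mem h]
    nlinarith [mul_nonneg hV (sq_nonneg ‖v‖)]
  · rw [Set.indicator_of_notMem h, add_zero]
    have hle : ‖v‖ ≤ V := not_lt.1 h
    calc ‖v‖ ^ 3 = ‖v‖ * ‖v‖ ^ 2 := by ring
      _ ≤ V * ‖v‖ ^ 2 := mul_le_mul_of_nonneg_right hle (sq_nonneg _)

/-- Along a trajectory with energy per particle `≤ Ē`, the mean cubic speed integrates in time to at most
`2VĒτ + ∫ mean cubeTail`. [folklore] -/
theorem setIntegral_mean_cube_le (hγ : IsHardSphereTrajectory (Torus.geometry (Fin 3)) ε (N + 1) γ) {V Ebar : ℝ}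
    (hV : 1 ≤ V) (hτ : 0 ≤ τ) (hE : ((N + 1 : ℕ) : ℝ)⁻¹ * configEnergy (γ 0) ≤ Ebar) :
    ∫ s in Set.Icc (0 : ℝ) τ, ((N + 1 : ℕ) : ℝ)⁻¹ * ∑ k, ‖(γ s k).2‖ ^ 3 ≤
      2 * V * Ebar * τ + ∫ s in Set.Icc (0 : ℝ) τ, ((N + 1 : ℕ) : ℝ)⁻¹ * ∑ k, cubeTail V (γ s k).2 := by
  set R := Real.sqrt (2 * configEnergy (γ 0)) with hRdef
  have hR : ∀ s k, ‖(γ s k).2‖ ≤ R := norm_vel_le_sqrt_of_isHardSphereTrajectory hγ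
  have hR0 : 0 ≤ R := Real.sqrt_nonneg _
  have hγm := hγ.measurable_torus
  have hvk : ∀ k : Fin (N + 1), Measurable fun s : ℝ => (γ s k).2 := fun k => ((measurable_pi_apply k).comp hγm).snd
  have hV0 : 0 ≤ V := zero_le_one.trans hV
  -- pointwise in time
  have hpt : ∀ s, ((N + 1 : ℕ) : ℝ)⁻¹ * ∑ k, ‖(γ s k).2‖ ^ 3 ≤
      2 * V * Ebar + ((N + 1 : ℕ) : ℝ)⁻¹ * ∑ k, cubeTail V (γ s k).2 := by
    intro s
    have hEs : ((N + 1 : ℕ) : ℝ)⁻¹ * configEnergy (γ s) ≤ Ebar := by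
      rw [IsHardSphereTrajectory.configEnergy_eq_holds hγ s 0]; exact hE
    have hsum : ∑ k, ‖(γ s k).2‖ ^ 3 ≤ V * (2 * configEnergy (γ s)) + ∑ k, cubeTail V (γ s k).2 := by
      calc ∑ k, ‖(γ s k).2‖ ^ 3 ≤ ∑ k, (V * ‖(γ s k).2‖ ^ 2 + cubeTail V (γ s k).2) :=
            Finset.sum_le_sum fun k _ => norm_cube_le hV0 _
        _ = V * (2 * configEnergy (γ s)) + ∑ k, cubeTail V (γ s k).2 := by
            rw [Finset.sum_add_distrib, ← Finset.mul_sum]; unfold configEnergy; ring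
    calc ((N + 1 : ℕ) : ℝ)⁻¹ * ∑ k, ‖(γ s k).2‖ ^ 3
        ≤ ((N + 1 : ℕ) : ℝ)⁻¹ * (V * (2 * configEnergy (γ s)) + ∑ k, cubeTail V (γ s k).2) :=
          mul_le_mul_of_nonneg_left hsum (by positivity)
      _ = 2 * V * (((N + 1 : ℕ) : ℝ)⁻¹ * configEnergy (γ s)) + ((N + 1 : ℕ) : ℝ)⁻¹ * ∑ k, cubeTail V (γ s k).2 := by ring
      _ ≤ _ := by nlinarith
  have hcb : ∀ s k, cubeTail V (γ s k).2 ≤ R ^ 3 := fun s k => by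
    unfold cubeTail
    by_cases h : (γ s k).2 ∈ {v : V3 | V < ‖v‖}
    · rw [Set.indicator_of_mem h]; exact pow_le_pow_left₀ (norm_nonneg _) (hR s k) 3
    · rw [Set.indicator_of_notMem h]; positivity
  have hint : ∀ {f : V3 → ℝ}, Measurable f → (∀ v, 0 ≤ f v) → (∀ s k, f (γ s k).2 ≤ R ^ 3) →
      IntegrableOn (fun s => ((N + 1 : ℕ) : ℝ)⁻¹ * ∑ k, f (γ s k).2) (Set.Icc (0 : ℝ) τ) volume := by
    intro f hf hf0 hfb
    refine Measure.integrableOn_of_bounded (M := ((N + 1 : ℕ) : ℝ)⁻¹ * ∑ _k : Fin (N + 1), R ^ 3)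
      (by rw [Real.volume_Icc]; exact ENNReal.ofReal_ne_top)
      ((measurable_const.mul (Finset.measurable_sum _ fun k _ => hf.comp (hvk k))).aestronglyMeasurable)
      (ae_of_all _ fun s => ?_)
    rw [Real.norm_eq_abs, abs_of_nonneg (mul_nonneg (by positivity) (Finset.sum_nonneg fun k _ => hf0 _))]
    exact mul_le_mul_of_nonneg_left (Finset.sum_le_sum fun k _ => hfb s k) (by positivity)
  have hi3 : IntegrableOn (fun s => ((N + 1 : ℕ) : ℝ)⁻¹ * ∑ k, ‖(γ s k).2‖ ^ 3) (Set.Icc (0 : ℝ) τ) volume :=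
    hint (measurable_norm.pow_const 3) (fun v => by positivity) fun s k => pow_le_pow_left₀ (norm_nonneg _) (hR s k) 3
  have hic : IntegrableOn (fun s => ((N + 1 : ℕ) : ℝ)⁻¹ * ∑ k, cubeTail V (γ s k).2) (Set.Icc (0 : ℝ) τ) volume :=
    hint (measurable_cubeTail V) (cubeTail_nonneg V) hcb
  have hcI : Integrable (fun _ : ℝ => 2 * V * Ebar) (volume.restrict (Set.Icc (0 : ℝ) τ)) :=
    (integrableOn_const (C := 2 * V * Ebar) (s := Set.Icc (0 : ℝ) τ) (μ := volume)
      (by rw [Real.volume_Icc]; exact ENNReal.ofReal_ne_top)).integrable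
  calc ∫ s in Set.Icc (0 : ℝ) τ, ((N + 1 : ℕ) : ℝ)⁻¹ * ∑ k, ‖(γ s k).2‖ ^ 3
      ≤ ∫ s in Set.Icc (0 : ℝ) τ, (2 * V * Ebar + ((N + 1 : ℕ) : ℝ)⁻¹ * ∑ k, cubeTail V (γ s k).2) :=
        integral_mono hi3 (hcI.add hic) hpt
    _ = _ := by
        rw [integral_add hcI hic, setIntegral_const, measureReal_def, Real.volume_Icc, sub_zero, ENNReal.toReal_ofReal hτ,
          smul_eq_mul]
        ring

end Moments

/-- **Registered sub-goal `stub_wciWindowConstant` (helper L of `stub_windowCovarianceIsotropy`): a constant window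
integrand integrates over `[0, τ] × 𝕋³` to `τ` times the constant** (`𝕋³` has unit Haar volume). [folklore] -/
theorem stub_wciWindowConstant : ∀ {τ : ℝ}, 0 ≤ τ → ∀ c : ℝ, ∫ _t₀ in Set.Icc (0 : ℝ) τ, ∫ _x₀ : T3, c = τ * c :=
  fun hτ c => winIntegral_const hτ c

end Summit.AtomisticToContinuum.HydrodynamicLimit.Theorems.ParityBandClosureWindowCovariance

end
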